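import Summits.HodgeConjecture.HodgeConjecture.Theorems.R90S4TypeOneFinerCount            -- ★ F5b (R90-C131-p01): CARTAN-ALL letter lemmas `centralizer_eq_of_mem_member`, `member_eq_of_isConj`; brings ★ F3b∕F3a∕F5a + the (B2-S) vocabulary
import Summits.HodgeConjecture.HodgeConjecture.Theorems.R90S4TypeTwoBlockFrameOfCharpoly   -- ★ FILE 0 (K2E4-p14): `charpoly_fin_one_of`; brings ★ F1″ `R90S4TypeTwoStableClassSplit` + ★ `LocalStableClassesNonsplitTypeTwoCount` (frame calculus)
import HarnessLib

/-!
# R90-TF · S4 «Ch. 13.1–2», (DICT)(2) file F3″a — UNIFORMITY ALONG A TYPE-(2) TORUS, ITS `(2,1)` FRAME, COMPACTNESS, AND THE CLOSURE OF TYPE (2) UNDER REGULAR POINTS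
# (Rogawski 1990, §3.5 Prop. 3.5.2 (a)(c), §3.6 type (2) `T = T_K × E¹`, §4.3, §12.5 p. 182)

Cell `hodgecm-mathlib`, crux H413 (`stmt-HodgeConjecture-24833`, lane `--supports … --as helper`), route of record `HCCMUnconditional` (no route verbs; count-neutral).
Programme R90-TF, section S4 (base `R90-C131`), dealer K2E2-plan (g8), CARD A = F3″ (S4-R38 2026-09-05T02:21:29Z; carve S4-R39 (5)∕S4-R41 (1): the two-element count
`natCard_stableSet_eq_two` is K2E4-p14's CARD A′ and is CONSUMED BY NAME in F3″b; exports asked for in S4-R40 (b), S4-R41 (1), S4-R43 (3) are §2–§3 here); seat K2E3-p12 (g11).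
THIS FILE is the type-(2) twin of ★ F3a `R90S4TypeOneTorusClasses`; the package itself is F3″b `R90S4TypeTwoMemberPackage`.  THEOREMS ONLY (no `def`, no `instance`, no
notation, no named-fact hypothesis, no `sorry`); ★-only imports; default heartbeats.

## THE MATHEMATICS
`G_v = Gqs L v = U(Φ₃)(L⁺_v)`, `v` NON-SPLIT (`L ⊗ L⁺_v = L_w` a field), `σ = c ⊗ 1`, `H = Φ₃` (★ `cmLocalForm L 3 v`).  TYPE (2): `γ₀ P = P·[A 0; 0 u]` with `χ_A` IRREDUCIBLE over
`L_w` (block pattern `e : Fin 2 ⊕ Fin 1 ≃ Fin 3`), so `char γ₀ = χ_A·(X − u)` is separable (`γ₀` regular), `σ(u)u = 1` and `ᵗσA·G₁·A = G₁` in the `H`-orthogonal frame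
`H_P = [G₁ 0; 0 g₃]` (★ `twistGram_blockFrame_eq`), and `Z_{M₃}(γ₀) = P·{[α + βA, 0; 0 c]}·P⁻¹ ≅ L_w[A] × L_w` (★ `commute_iff_exists_smul_one_add_smul_of_irreducible`).
* §1 UNIFORMITY ALONG `T^{reg}` (generic, replaces F3a's norm tests): the `M₃(L_w)`-commutant of a REGULAR element is commutative (★ `commute_of_commute_of_isRegularElt_local`),
  hence for `t ∈ Z_{G_v}(γ₀)` regular and ANY `g ∈ GL₃(L_w)` with `g γ₀ g⁻¹ = δ ∈ G_v`, `g t g⁻¹ = s ∈ G_v`: **`t ∼ s ⟺ γ₀ ∼ δ`** (a `G_v`-conjugator `c` of one pair gives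
  `c⁻¹g ∈ Z(γ₀) = Z(t)`, so `c` conjugates the other pair too) — «the invariant `inv(t, ·) ∈ 𝔇(T∕F)` does not depend on the regular point `t ∈ T`» [§3.5 p. 29].
* §2 THE FRAME: **`charpoly_eq_mul_of_blockFrame`** `char γ₀ = χ_A·(X − C u)`; regularity; the Gram data (`σ(u)u = 1`, `σ(det A)·det A = 1`); type (2) is NOT hyperbolic (a root of
  `χ_A·(X − u)` in `L_w` is `u`, on the norm-one torus; ★ `exists_isRoot_of_mem_hyperbolicSet`), so **`isCompact_centralizer_of_blockFrame`**: `Z(γ₀)` is COMPACT (★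
  `isCompact_centralizer_of_not_mem_hyperbolicSet`) — `T_K × E¹` is anisotropic, hence `≠ M` for the Weyl-weight clause (W).
* §3 THE CLOSURE **`exists_blockFrame_of_mem_centralizer_of_isRegularElt`**: a REGULAR `t ∈ Z_{G_v}(γ₀)` is again of type (2) IN THE SAME FRAME — `t P = P·[B 0; 0 c]` with
  `B = α + βA ∈ L_w[A]`, and `β ≠ 0` (else `char t = (X − α)²(X − c)` is inseparable), so `B` has no eigenvalue in `L_w` (★ `eq_zero_of_det_smul_one_add_smul_eq_zero`) and the monic
  quadratic `χ_B` is irreducible.  Twin of ★ F3a `exists_eigenframe_coords_of_mem_centralizer`; it lets the (DICT-Σ) assembler re-enter the type-(2) bricks at any regular `t_k`.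

HONEST LABEL: HC_CM is proved only modulo the 7 printed citations (2 remaining named inputs: hLiu418 = stmt-HodgeConjecture-24832, h413 = stmt-HodgeConjecture-24833) until rung 0
closes.  Inputs of the type-(2) member package F3″ ((DICT)(2)) behind ★ (B2-S) behind the OPEN (W-NP); discharges no named input.  REL ≠ ★ ≠ BUILT.

## References
* [Rogawski1990] J. D. Rogawski, *Automorphic Representations of Unitary Groups in Three Variables*, Ann. of Math. Stud. 123 (1990), §3.1 p. 19, §3.5 Prop. 3.5.2 (a)(c) p. 29,
  §3.6 pp. 28–31, §4.3 pp. 43–44, §12.5 p. 182.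
* [HornJohnson2013] R. A. Horn, C. R. Johnson, *Matrix Analysis*, 2nd ed. (2013), §0.9.2 (direct sums), §1.3 (similarity), §3.2.4.
-/

set_option autoImplicit false
set_option linter.dupNamespace false

open NumberField IsDedekindDomain Polynomial Matrix
open scoped MatrixGroups
open Literature.NumberTheory.Rogawski1990 Literature.NumberTheory.Automorphic Literature.NumberTheory.Automorphic.UnitaryGroup
open Literature.AlgebraicGeometry.ShimuraVarieties (unitaryGroup mem_unitaryGroup_iff)
open Literature.LinearAlgebra.Matrix (eval_charpoly_ne_zero_of_irreducible commute_iff_exists_smul_one_add_smul_of_irreducible)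
open Summit.HodgeConjecture.HodgeConjecture.Cruxes.H413

namespace Summit.HodgeConjecture.HodgeConjecture.R90.S4

section TypeTwoClasses

variable (L : Type) [Field L] [NumberField L] [IsCMField L] (v : HeightOneSpectrum (𝓞 ↥(maximalRealSubfield L)))

variable {L v}

/-! ## §1 Uniformity along the regular set of a torus: conjugacy of transports is decided at one regular point -/

/-- **TRANSPORTING CONJUGACY ALONG A COMMUTING PAIR.**  Let `a ∈ G_v` be regular and `b ∈ G_v` commute with `a`; let `g ∈ GL₃(L ⊗ L⁺_v)` conjugate `a ↦ a′ ∈ G_v` and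
`b ↦ b′ ∈ G_v`.  If `a ∼ a′` in `G_v` then `b ∼ b′` in `G_v`: a `G_v`-conjugator `c` with `c a c⁻¹ = a′ = g a g⁻¹` gives `c⁻¹g ∈ Z(a)`, which is commutative (★
`commute_of_commute_of_isRegularElt_local`) and contains `b`, so `g b g⁻¹ = c b c⁻¹`. [cite: Rogawski1990, §3.5 Prop. 3.5.2 (a) p. 29; §4.3 pp. 43–44] -/
theorem isConj_of_isConj_of_conj_eq_of_commute {a a' b b' : Gqs L v} (hrega : IsRegularElt (a.val : GL (Fin 3) (LocalRing L v))) (hab : b * a = a * b)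
    {g : GL (Fin 3) (LocalRing L v)} (hga : g * a.val * g⁻¹ = a'.val) (hgb : g * b.val * g⁻¹ = b'.val) (h : IsConj a a') : IsConj b b' := by
  obtain ⟨c, hc⟩ := isConj_iff.1 h
  have hc' : c.val * a.val * c.val⁻¹ = g * a.val * g⁻¹ := by rw [hga]; exact congrArg Subtype.val hc
  -- `c⁻¹ g` commutes with `a`, hence with `b`
  have h2 : c.val⁻¹ * g * a.val = a.val * (c.val⁻¹ * g) := by
    calc c.val⁻¹ * g * a.val = c.val⁻¹ * (g * a.val * g⁻¹) * g := by group
      _ = c.val⁻¹ * (c.val * a.val * c.val⁻¹) * g := by rw [hc']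
      _ = a.val * (c.val⁻¹ * g) := by group
  have h1 : Commute ((c.val⁻¹).val * g.val) (a.val : GL (Fin 3) (LocalRing L v)).val := by
    have h3 := congrArg (fun x : GL (Fin 3) (LocalRing L v) => x.val) h2
    simp only [Units.val_mul] at h3
    exact h3
  have hba : Commute (b.val : GL (Fin 3) (LocalRing L v)).val (a.val : GL (Fin 3) (LocalRing L v)).val :=
    congrArg (fun x : Gqs L v => (x.val : GL (Fin 3) (LocalRing L v)).val) hab
  have hcomm := commute_of_commute_of_isRegularElt_local L v a hrega _ _ h1 hba
  have h4 : c.val⁻¹ * g * b.val = b.val * (c.val⁻¹ * g) := Units.ext (by simpa only [Units.val_mul] using hcomm.eq)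
  have h5 : c.val * b.val * c.val⁻¹ = b'.val := by
    rw [← hgb]
    calc c.val * b.val * c.val⁻¹ = c.val * (b.val * (c.val⁻¹ * g)) * g⁻¹ := by group
      _ = c.val * (c.val⁻¹ * g * b.val) * g⁻¹ := by rw [h4]
      _ = g * b.val * g⁻¹ := by group
  exact isConj_iff.2 ⟨c, Subtype.ext h5⟩

/-- **UNIFORMITY ALONG `T^{reg}`: `t ∼ s ⟺ γ₀ ∼ δ`.**  For `γ₀ ∈ G_v` regular, `t ∈ Z_{G_v}(γ₀)` regular, and `g ∈ GL₃(L ⊗ L⁺_v)` with `g γ₀ g⁻¹ = δ ∈ G_v` and `g t g⁻¹ = s ∈ G_v`, the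
transport `s` of `t` is conjugate to `t` iff the transport `δ` of `γ₀` is conjugate to `γ₀` — the class invariant of a stable conjugator is read at any regular point of the torus
(`Z(γ₀) = Z(t)` is commutative).  This is what makes the `|𝔇(T∕F)|` classes of ★ F1″ serve every regular point of `T = Z(γ₀)`. [cite: Rogawski1990, §3.5 Prop. 3.5.2 (a)(c) p. 29; §3.6 p. 31] -/
theorem isConj_iff_isConj_of_conj_eq {γ₀ t δ s : Gqs L v} (hreg₀ : IsRegularElt (γ₀.val : GL (Fin 3) (LocalRing L v)))
    (hreg : IsRegularElt (t.val : GL (Fin 3) (LocalRing L v))) (ht : t ∈ Subgroup.centralizer ({γ₀} : Set (Gqs L v)))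
    {g : GL (Fin 3) (LocalRing L v)} (hgγ : g * γ₀.val * g⁻¹ = δ.val) (hgt : g * t.val * g⁻¹ = s.val) : IsConj t s ↔ IsConj γ₀ δ := by
  have htγ : t * γ₀ = γ₀ * t := Subgroup.mem_centralizer_singleton_iff.1 ht
  exact ⟨fun h => isConj_of_isConj_of_conj_eq_of_commute hreg htγ.symm hgt hgγ h, fun h => isConj_of_isConj_of_conj_eq_of_commute hreg₀ htγ hgγ hgt h⟩

/-! ## §2 The `(2,1)` block frame of a type-(2) element: characteristic polynomial, regularity, the norm-one corner, compactness -/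

/-- **`char γ = χ_A · (X − u)` IN A `(2,1)` BLOCK FRAME** `γ P = P·[A 0; 0 u]` (similarity invariance + block-triangular determinant; ★ `charpoly_fin_one_of`).  The frame-equation
form every (DICT)(2) hand feeds (S4-R41 (1)). [cite: HornJohnson2013, §0.9.2, §1.3; Rogawski1990, §3.6 p. 31] -/
theorem charpoly_eq_mul_of_blockFrame {K : Type*} [Field K] {γ : Matrix (Fin 3) (Fin 3) K} (P : GL (Fin 3) K) (e : Fin 2 ⊕ Fin 1 ≃ Fin 3)
    (A : Matrix (Fin 2) (Fin 2) K) (u : K) (hP : γ * P.val = P.val * reindex e e (fromBlocks A 0 0 !![u])) :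
    γ.charpoly = A.charpoly * (X - C u) := by
  have hγ : γ = P.val * reindex e e (fromBlocks A 0 0 !![u]) * (P⁻¹).val := by
    rw [← hP, Matrix.mul_assoc, ← Units.val_mul, mul_inv_cancel, Units.val_one, Matrix.mul_one]
  rw [hγ, Matrix.coe_units_inv, Matrix.charpoly_units_conj, Matrix.charpoly_reindex, Matrix.charpoly_fromBlocks_zero₁₂, charpoly_fin_one_of]

/-- A right frame equation from a conjugation formula: `x = Q·D·Q⁻¹ ⇒ x Q = Q D`. [cite: HornJohnson2013, §0.9.2] -/
theorem mul_eq_mul_of_eq_conj {K : Type*} [CommRing K] {x D : Matrix (Fin 3) (Fin 3) K} {Q : GL (Fin 3) K} (h : x = Q.val * D * (Q⁻¹).val) :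
    x * Q.val = Q.val * D := by
  rw [h, Matrix.mul_assoc, ← Units.val_mul, inv_mul_cancel, Units.val_one, Matrix.mul_one]

/-- **THE UNITARY FRAME DATA OF A TYPE-(2) ELEMENT** (`v` non-split): for `γ₀ ∈ G_v` with `γ₀ P = P·[A 0; 0 u]`, `χ_A` irreducible, the Gram matrix of the frame is block diagonal,
`H_P = [G₁ 0; 0 g₃]` with `G₁` hermitian invertible, `g₃ = σ g₃ ≠ 0`, `ᵗσA·G₁·A = G₁` (the block is `G₁`-unitary), and the corner is on the norm-one torus: **`σ(u)·u = 1`**;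
moreover `σ(det A)·det A = 1`.  (★ `twistGram_blockFrame_eq` + ★ `blockFrame_gram_hermitian`.) [cite: Rogawski1990, §3.6 p. 31; §3.5 p. 29] -/
theorem exists_gram_blockFrame (hns : ∀ w : PlacesOver L v, IsCMField.complexConj L • w.1 = w.1) {γ₀ : Gqs L v} (P : GL (Fin 3) (LocalRing L v))
    (e : Fin 2 ⊕ Fin 1 ≃ Fin 3) (A : Matrix (Fin 2) (Fin 2) (LocalRing L v)) (u : LocalRing L v)
    (hP : γ₀.val.val * P.val = P.val * reindex e e (fromBlocks A 0 0 !![u])) (hA : Irreducible A.charpoly) :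
    ∃ (G₁ : Matrix (Fin 2) (Fin 2) (LocalRing L v)) (g₃ : LocalRing L v),
      twistGram (conjLocal L (IsCMField.complexConj L) v) (cmLocalForm L 3 v) P.val = reindex e e (fromBlocks G₁ 0 0 !![g₃]) ∧
      (A.map (conjLocal L (IsCMField.complexConj L) v))ᵀ * G₁ * A = G₁ ∧ (G₁.map (conjLocal L (IsCMField.complexConj L) v))ᵀ = G₁ ∧ IsUnit G₁.det ∧
      conjLocal L (IsCMField.complexConj L) v g₃ = g₃ ∧ g₃ ≠ 0 ∧
      conjLocal L (IsCMField.complexConj L) v u * u = 1 ∧ conjLocal L (IsCMField.complexConj L) v A.det * A.det = 1 := by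
  obtain ⟨w⟩ := (inferInstance : Nonempty (PlacesOver L v))
  letI : Field (LocalRing L v) := (LocalRing.isField_of_smul_eq (IsCMField.complexConj L) (IsCMField.complexConj_ne_one L) w (hns w)).toField
  have hσσ : ∀ x : LocalRing L v, conjLocal L (IsCMField.complexConj L) v (conjLocal L (IsCMField.complexConj L) v x) = x := conjLocal_conjLocal_cm L v
  have hH : IsUnit (cmLocalForm L 3 v).det := by
    rw [cmLocalForm_eq_over]; exact (Matrix.isUnit_iff_isUnit_det _).1 ((StdForm.antidiagonal 3).isUnit_over _)
  have hHh : ((cmLocalForm L 3 v).map (conjLocal L (IsCMField.complexConj L) v))ᵀ = cmLocalForm L 3 v := by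
    rw [cmLocalForm_eq_over, StdForm.over_map, StdForm.transpose_over]
  have hγU : γ₀.val ∈ unitaryGroup (conjLocal L (IsCMField.complexConj L) v) (cmLocalForm L 3 v) := by
    rw [← unitaryGroupOfForm_cmLocalForm_eq_unitaryGroup]; exact γ₀.2
  have hA' : ∀ c : LocalRing L v, A.charpoly.eval c ≠ 0 := eval_charpoly_ne_zero_of_irreducible hA (by simp)
  obtain ⟨G₁, g₃, hT, hAu, hug⟩ := twistGram_blockFrame_eq (conjLocal L (IsCMField.complexConj L) v) e (cmLocalForm L 3 v) hσσ hγU hP hA'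
  obtain ⟨hG₁h, hg₃σ, hG₁d, hg₃0⟩ := blockFrame_gram_hermitian (conjLocal L (IsCMField.complexConj L) v) e (cmLocalForm L 3 v) hσσ hHh hH.ne_zero hT
  refine ⟨G₁, g₃, hT, hAu, hG₁h, Ne.isUnit hG₁d, hg₃σ, hg₃0, ?_, ?_⟩
  · -- `σ(u) g₃ u = g₃`, `g₃ ≠ 0`
    have h1 : conjLocal L (IsCMField.complexConj L) v u * u * g₃ = 1 * g₃ := by rw [one_mul, mul_right_comm]; exact hug
    exact mul_right_cancel₀ hg₃0 h1
  · -- determinants in `ᵗσA·G₁·A = G₁`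
    have h1 := congrArg Matrix.det hAu
    rw [Matrix.det_mul, Matrix.det_mul, Matrix.det_transpose, ← RingHom.mapMatrix_apply, ← RingHom.map_det] at h1
    have h2 : conjLocal L (IsCMField.complexConj L) v A.det * A.det * G₁.det = 1 * G₁.det := by
      rw [one_mul]
      calc conjLocal L (IsCMField.complexConj L) v A.det * A.det * G₁.det = conjLocal L (IsCMField.complexConj L) v A.det * G₁.det * A.det := by ring
        _ = G₁.det := h1
    exact mul_right_cancel₀ hG₁d h2

/-- **A TYPE-(2) ELEMENT IS REGULAR**: `char γ₀ = χ_A·(X − u)` is separable — `χ_A` is irreducible (separable in characteristic `0`) and prime to `X − u` (`χ_A(u) ≠ 0`).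
[cite: Rogawski1990, §3.6 p. 31] -/
theorem isRegularElt_of_blockFrame (hns : ∀ w : PlacesOver L v, IsCMField.complexConj L • w.1 = w.1) {γ₀ : Gqs L v} (P : GL (Fin 3) (LocalRing L v))
    (e : Fin 2 ⊕ Fin 1 ≃ Fin 3) (A : Matrix (Fin 2) (Fin 2) (LocalRing L v)) (u : LocalRing L v)
    (hP : γ₀.val.val * P.val = P.val * reindex e e (fromBlocks A 0 0 !![u])) (hA : Irreducible A.charpoly) :
    IsRegularElt (γ₀.val : GL (Fin 3) (LocalRing L v)) := by
  obtain ⟨w⟩ := (inferInstance : Nonempty (PlacesOver L v))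
  letI : Field (LocalRing L v) := (LocalRing.isField_of_smul_eq (IsCMField.complexConj L) (IsCMField.complexConj_ne_one L) w (hns w)).toField
  haveI : CharZero (LocalRing L v) := charZero_of_injective_algebraMap (algebraMap L (LocalRing L v)).injective
  have hA' : ∀ c : LocalRing L v, A.charpoly.eval c ≠ 0 := eval_charpoly_ne_zero_of_irreducible hA (by simp)
  rw [isRegularElt_iff, charpoly_eq_mul_of_blockFrame P e A u hP]
  refine hA.separable.mul (Polynomial.separable_X_sub_C) ?_
  refine ((Polynomial.irreducible_X_sub_C u).coprime_iff_not_dvd.2 fun hdvd => ?_).symm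
  exact hA' u (Polynomial.dvd_iff_isRoot.1 hdvd)

/-- **TYPE (2) IS NOT HYPERBOLIC** (`v` non-split): a root in `L_w` of `char γ₀ = χ_A·(X − u)` is `u`, which lies on the norm-one torus (`σ(u)u = 1`), whereas an element of `Ω` has an
eigenvalue off it (★ `exists_isRoot_of_mem_hyperbolicSet`). [cite: Rogawski1990, §3.6 pp. 30–31; §12.5 p. 182] -/
theorem not_mem_hyperbolicSet_of_blockFrame (hns : ∀ w : PlacesOver L v, IsCMField.complexConj L • w.1 = w.1) {γ₀ : Gqs L v} (P : GL (Fin 3) (LocalRing L v))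
    (e : Fin 2 ⊕ Fin 1 ≃ Fin 3) (A : Matrix (Fin 2) (Fin 2) (LocalRing L v)) (u : LocalRing L v)
    (hP : γ₀.val.val * P.val = P.val * reindex e e (fromBlocks A 0 0 !![u])) (hA : Irreducible A.charpoly) :
    γ₀ ∉ F0P3cStCharTSTorusDefs.hyperbolicSet L v := by
  intro hΩ
  obtain ⟨w⟩ := (inferInstance : Nonempty (PlacesOver L v))
  letI : Field (LocalRing L v) := (LocalRing.isField_of_smul_eq (IsCMField.complexConj L) (IsCMField.complexConj_ne_one L) w (hns w)).toField
  have hA' : ∀ c : LocalRing L v, A.charpoly.eval c ≠ 0 := eval_charpoly_ne_zero_of_irreducible hA (by simp)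
  obtain ⟨-, -, -, -, -, -, -, -, hu1, -⟩ := exists_gram_blockFrame hns P e A u hP hA
  obtain ⟨α, hα, hne⟩ := F0P3cStCharTSHyperbolicSetEigen.exists_isRoot_of_mem_hyperbolicSet L v hΩ
  have hα' : (A.charpoly * (X - C u)).IsRoot α := by rw [← charpoly_eq_mul_of_blockFrame P e A u hP]; exact hα
  rw [Polynomial.IsRoot, Polynomial.eval_mul, mul_eq_zero] at hα'
  rcases hα' with h | h
  · exact hA' α h
  · rw [eval_sub, eval_X, eval_C, sub_eq_zero] at h
    exact hne (by rw [h, mul_comm]; exact hu1)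

/-- **TYPE-(2) CENTRALISERS ARE COMPACT** (`v` non-split): `Z_{G_v}(γ₀) ≅ T_K × E¹` is compact (★ «ELL-CARTAN-COMPACT» `isCompact_centralizer_of_not_mem_hyperbolicSet` + §2).
[cite: Rogawski1990, §3.6 pp. 30–31; §12.5 p. 184] -/
theorem isCompact_centralizer_of_blockFrame (hns : ∀ w : PlacesOver L v, IsCMField.complexConj L • w.1 = w.1) {γ₀ : Gqs L v} (P : GL (Fin 3) (LocalRing L v))
    (e : Fin 2 ⊕ Fin 1 ≃ Fin 3) (A : Matrix (Fin 2) (Fin 2) (LocalRing L v)) (u : LocalRing L v)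
    (hP : γ₀.val.val * P.val = P.val * reindex e e (fromBlocks A 0 0 !![u])) (hA : Irreducible A.charpoly) :
    IsCompact ((Subgroup.centralizer ({γ₀} : Set (Gqs L v))) : Set (Gqs L v)) :=
  F0P3cStCharTSEllCartanCompact.isCompact_centralizer_of_not_mem_hyperbolicSet L v hns (isRegularElt_of_blockFrame hns P e A u hP hA)
    (not_mem_hyperbolicSet_of_blockFrame hns P e A u hP hA)

/-! ## §3 The closure: a regular point of a type-(2) torus is of type (2) in the same frame -/

/-- **A REGULAR `t ∈ Z(γ₀)` IS OF TYPE (2) IN THE SAME FRAME** (`v` non-split): if `γ₀ P = P·[A 0; 0 u]` with `χ_A` irreducible and `t ∈ Z_{G_v}(γ₀)` is regular, then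
`t P = P·[B 0; 0 c]` with `χ_B` IRREDUCIBLE — `t = P·[α + βA, 0; 0 c]·P⁻¹` (★ `commute_iff_exists_smul_one_add_smul_of_irreducible`), `β ≠ 0` (else `char t = (X − α)²·(X − c)`
would not be separable), so `B = α + βA` has no eigenvalue in `L_w` (★ `eq_zero_of_det_smul_one_add_smul_eq_zero`) and the monic quadratic `χ_B` is irreducible.  Type-(2) twin of
★ F3a `exists_eigenframe_coords_of_mem_centralizer`; the (DICT-Σ) assembler feeds the type-(2) bricks at any regular `t_k` through it (S4-R40 (b)). [cite: Rogawski1990, §3.6 p. 31; §12.5 p. 182] -/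
theorem exists_blockFrame_of_mem_centralizer_of_isRegularElt (hns : ∀ w : PlacesOver L v, IsCMField.complexConj L • w.1 = w.1) {γ₀ : Gqs L v}
    (P : GL (Fin 3) (LocalRing L v)) (e : Fin 2 ⊕ Fin 1 ≃ Fin 3) (A : Matrix (Fin 2) (Fin 2) (LocalRing L v)) (u : LocalRing L v)
    (hP : γ₀.val.val * P.val = P.val * reindex e e (fromBlocks A 0 0 !![u])) (hA : Irreducible A.charpoly) {t : Gqs L v}
    (ht : t ∈ Subgroup.centralizer ({γ₀} : Set (Gqs L v))) (hreg : IsRegularElt (t.val : GL (Fin 3) (LocalRing L v))) :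
    ∃ (B : Matrix (Fin 2) (Fin 2) (LocalRing L v)) (c : LocalRing L v),
      t.val.val * P.val = P.val * reindex e e (fromBlocks B 0 0 !![c]) ∧ Irreducible B.charpoly := by
  obtain ⟨w⟩ := (inferInstance : Nonempty (PlacesOver L v))
  letI : Field (LocalRing L v) := (LocalRing.isField_of_smul_eq (IsCMField.complexConj L) (IsCMField.complexConj_ne_one L) w (hns w)).toField
  have hA' : ∀ c : LocalRing L v, A.charpoly.eval c ≠ 0 := eval_charpoly_ne_zero_of_irreducible hA (by simp)
  have htc : Commute t.val.val γ₀.val.val := congrArg (fun g : Gqs L v => g.val.val) (Subgroup.mem_centralizer_singleton_iff.1 ht)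
  obtain ⟨α, β, c, htv⟩ := (commute_iff_exists_smul_one_add_smul_of_irreducible hP hA).1 htc
  have hframe : t.val.val * P.val = P.val * reindex e e (fromBlocks (α • 1 + β • A) 0 0 !![c]) := mul_eq_mul_of_eq_conj htv
  refine ⟨α • 1 + β • A, c, hframe, ?_⟩
  -- `char t = χ_B · (X − c)` is separable
  have hsep : ((α • (1 : Matrix (Fin 2) (Fin 2) (LocalRing L v)) + β • A).charpoly * (X - C c)).Separable := by
    rw [← charpoly_eq_mul_of_blockFrame P e _ c hframe]; exact (isRegularElt_iff _).1 hreg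
  -- hence `β ≠ 0`
  have hβ : β ≠ 0 := by
    intro hβ0
    rw [hβ0, zero_smul, add_zero, Matrix.smul_one_eq_diagonal, charpoly_diagonal, Fin.prod_univ_two] at hsep
    have hsq := (hsep.of_mul_left).squarefree
    exact Polynomial.not_isUnit_X_sub_C α (hsq (X - C α) (dvd_refl _))
  -- `χ_B` is a monic quadratic without roots in `L_w`
  have hmonic : (α • (1 : Matrix (Fin 2) (Fin 2) (LocalRing L v)) + β • A).charpoly.Monic := Matrix.charpoly_monic _
  have hdeg : (α • (1 : Matrix (Fin 2) (Fin 2) (LocalRing L v)) + β • A).charpoly.natDegree = 2 := by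
    rw [Matrix.charpoly_natDegree_eq_dim, Fintype.card_fin]
  refine (hmonic.irreducible_iff_roots_eq_zero_of_degree_le_three (by omega) (by omega)).2 (Multiset.eq_zero_of_forall_notMem fun a ha => ?_)
  rw [Polynomial.mem_roots hmonic.ne_zero, Polynomial.IsRoot, Matrix.eval_charpoly] at ha
  have e1 : Matrix.scalar (Fin 2) a - (α • (1 : Matrix (Fin 2) (Fin 2) (LocalRing L v)) + β • A) = (a - α) • (1 : Matrix (Fin 2) (Fin 2) (LocalRing L v)) + (-β) • A := by
    rw [Matrix.scalar_apply, ← Matrix.smul_one_eq_diagonal]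
    module
  rw [e1] at ha
  exact hβ (neg_eq_zero.1 (eq_zero_of_det_smul_one_add_smul_eq_zero hA' ha).2)

end TypeTwoClasses

end Summit.HodgeConjecture.HodgeConjecture.R90.S4
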